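import Literature.Analysis.FluidPDE.WholeSpaceIBPIntegrable
import HarnessLib

/-!
# Tools for rung 2 of `QuarterLogPincer.LogCubeSharp` (item stmt-NavierStokesRegularity-23935):
# the regularised cube `Φ(v) = (‖v‖²+1)^{3/2} − 1`, its weight `ρ(v) = (‖v‖²+1)^{1/2}`, calculus

Helper file (`--supports stmt-NavierStokesRegularity-23935`) of the crux `LogCubeSharp` of route
`QuarterLogPincer` (sharp logarithmic cube ceiling `‖u(t)‖₃³ ≤ C₁ + C₂ log(T/(T−t))` under the
quarter-rate enstrophy law and the velocity Type-I rate). Rung 2 of the planner's ladder is the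
`L³` ENERGY IDENTITY `d/dt ∫|u|³ ≤ 3∫|p||u||∇u|`. To avoid the non-smooth integrand `|u|³` (and any
limiting procedure) the line works with the REGULARISED CUBE

  `Φ(v) = (‖v‖² + 1)^{3/2} − 1`,  `DΦ(v)·w = 3 ρ(v) ⟪v, w⟫`,  `ρ(v) = (‖v‖² + 1)^{1/2}`,

which is smooth, integrable for `v ∈ L² ∩ L^∞`, and pinches the cube:
`‖v‖³ ≤ Φ(v) ≤ (‖v‖ + 3/2)‖v‖²` (`norm_pow_three_le_phi`, `phi_le`) — so an a-priori bound on
`∫ Φ(u(t))` IS a bound on `‖u(t)‖₃³`, up to the energy `∫|u|²`. This file (solution-free):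

* pointwise algebra of `ρ`, `Φ` (`one_le_…`, `norm_le_…`, `…_le`, `…_pos`, `norm_pow_three_le_phi`,
  `phi_le`, `phi_nonneg`);
* chain rules `D(ρ∘u) = ρ⁻¹⟪u, Du·⟫`, `D(Φ∘u) = 3ρ⟪u, Du·⟫` (`hasFDerivAt_sqrt_normSq_add_one`,
  `hasFDerivAt_phi`, applied forms, `C^n` regularity);
* `L² × L² ⊂ L¹` bookkeeping (`integrable_norm_mul_norm`, `integrable_norm_sq`).

HONEST FRAMING: calculus lemmas; nothing here concerns Navier–Stokes regularity, and the crux is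
NOT closed by this file. [folklore]
-/

noncomputable section

open MeasureTheory TopologicalSpace Set Function Filter Topology InnerProductSpace
open Literature.Analysis Literature.Analysis.FluidPDE
open scoped RealInnerProductSpace ENNReal NNReal Laplacian

namespace Summit.NavierStokesRegularity.NavierStokesRegularity.Theorems

-- the problem directory repeats the summit name (`NavierStokesRegularity/NavierStokesRegularity`)
set_option linter.dupNamespace false

namespace LogCubeSharp


section Pointwise

variable {V : Type*} [NormedAddCommGroup V]

/-! ### The regularised cube `Φ(v) = (‖v‖²+1)^{3/2} − 1` and its weight `ρ(v) = (‖v‖²+1)^{1/2}` -/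

/-- `1 ≤ √(‖v‖²+1)`. [folklore] -/
theorem one_le_sqrt_normSq_add_one (v : V) : 1 ≤ Real.sqrt (‖v‖ ^ 2 + 1) := by
  rw [Real.le_sqrt zero_le_one (by positivity)]
  nlinarith [sq_nonneg ‖v‖]

/-- `‖v‖ ≤ √(‖v‖²+1)`. [folklore] -/
theorem norm_le_sqrt_normSq_add_one (v : V) : ‖v‖ ≤ Real.sqrt (‖v‖ ^ 2 + 1) := by
  rw [Real.le_sqrt (norm_nonneg _) (by positivity)]
  linarith

/-- `√(‖v‖²+1) ≤ ‖v‖ + 1`. [folklore] -/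
theorem sqrt_normSq_add_one_le (v : V) : Real.sqrt (‖v‖ ^ 2 + 1) ≤ ‖v‖ + 1 := by
  rw [Real.sqrt_le_left (by positivity)]
  nlinarith [norm_nonneg v]

/-- `0 < √(‖v‖²+1)`. [folklore] -/
theorem sqrt_normSq_add_one_pos (v : V) : 0 < Real.sqrt (‖v‖ ^ 2 + 1) :=
  Real.sqrt_pos.2 (by positivity)

/-- **The cube is dominated by the regularised cube**: `‖v‖³ ≤ √(‖v‖²+1)³ − 1`
(`ρ³ = ρ‖v‖² + ρ ≥ ‖v‖·‖v‖² + 1`). [folklore] -/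
theorem norm_pow_three_le_phi (v : V) : ‖v‖ ^ 3 ≤ Real.sqrt (‖v‖ ^ 2 + 1) ^ 3 - 1 := by
  set ρ := Real.sqrt (‖v‖ ^ 2 + 1) with hρ
  have hρ2 : ρ ^ 2 = ‖v‖ ^ 2 + 1 := Real.sq_sqrt (by positivity)
  have h1 : 1 ≤ ρ := one_le_sqrt_normSq_add_one v
  have h2 : ‖v‖ ≤ ρ := norm_le_sqrt_normSq_add_one v
  have h3 : ρ ^ 3 = ρ * ‖v‖ ^ 2 + ρ := by
    calc ρ ^ 3 = ρ * ρ ^ 2 := by ring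
      _ = ρ * ‖v‖ ^ 2 + ρ := by rw [hρ2]; ring
  rw [h3]
  nlinarith [norm_nonneg v, sq_nonneg ‖v‖]

/-- **The regularised cube is dominated by cube plus square**:
`√(‖v‖²+1)³ − 1 ≤ (‖v‖ + 3/2)‖v‖²` (`ρ ≤ ‖v‖ + 1` and `ρ − 1 ≤ ‖v‖²/2`). [folklore] -/
theorem phi_le (v : V) : Real.sqrt (‖v‖ ^ 2 + 1) ^ 3 - 1 ≤ (‖v‖ + 3 / 2) * ‖v‖ ^ 2 := by
  set ρ := Real.sqrt (‖v‖ ^ 2 + 1) with hρ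
  have hρ2 : ρ ^ 2 = ‖v‖ ^ 2 + 1 := Real.sq_sqrt (by positivity)
  have h1 : 1 ≤ ρ := one_le_sqrt_normSq_add_one v
  have h4 : ρ ≤ ‖v‖ + 1 := sqrt_normSq_add_one_le v
  have h3 : ρ ^ 3 = ρ * ‖v‖ ^ 2 + ρ := by
    calc ρ ^ 3 = ρ * ρ ^ 2 := by ring
      _ = ρ * ‖v‖ ^ 2 + ρ := by rw [hρ2]; ring
  -- `ρ - 1 ≤ ‖v‖² / 2` since `(ρ - 1)(ρ + 1) = ‖v‖²` and `ρ + 1 ≥ 2`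
  have h5 : ρ - 1 ≤ ‖v‖ ^ 2 / 2 := by nlinarith
  rw [h3]
  nlinarith [norm_nonneg v, sq_nonneg ‖v‖]

/-- `0 ≤ √(‖v‖²+1)³ − 1`. [folklore] -/
theorem phi_nonneg (v : V) : 0 ≤ Real.sqrt (‖v‖ ^ 2 + 1) ^ 3 - 1 :=
  (pow_nonneg (norm_nonneg v) 3).trans (norm_pow_three_le_phi v)

end Pointwise

/-! ### Differentiating the weight and the regularised cube along a field -/

section Calculus

variable {E : Type*} [NormedAddCommGroup E] [InnerProductSpace ℝ E]
variable {G : Type*} [NormedAddCommGroup G] [NormedSpace ℝ G]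

/-- **Chain rule for the weight**: `D(√(‖u‖²+1))(x) = ρ(x)⁻¹ ⟪u(x), Du(x)·⟫`. [folklore] -/
theorem hasFDerivAt_sqrt_normSq_add_one {u : G → E} {u' : G →L[ℝ] E} {x : G}
    (hu : HasFDerivAt u u' x) :
    HasFDerivAt (fun y => Real.sqrt (‖u y‖ ^ 2 + 1))
      ((Real.sqrt (‖u x‖ ^ 2 + 1))⁻¹ • (innerSL ℝ (u x)).comp u') x := by
  have hpos : 0 < Real.sqrt (‖u x‖ ^ 2 + 1) := sqrt_normSq_add_one_pos (u x)
  have h1 : HasFDerivAt (fun y => ‖u y‖ ^ 2 + 1) (2 • (innerSL ℝ (u x)).comp u') x :=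
    hu.norm_sq.add_const 1
  refine (h1.sqrt (by positivity)).congr_fderiv (ContinuousLinearMap.ext fun w => ?_)
  simp only [_root_.smul_apply, ContinuousLinearMap.comp_apply, innerSL_apply_apply,
    smul_eq_mul, nsmul_eq_mul, Nat.cast_ofNat]
  field_simp

/-- **Chain rule for the regularised cube**: `D(√(‖u‖²+1)³ − 1)(x) = 3ρ(x) ⟪u(x), Du(x)·⟫`.
[folklore] -/
theorem hasFDerivAt_phi {u : G → E} {u' : G →L[ℝ] E} {x : G} (hu : HasFDerivAt u u' x) :
    HasFDerivAt (fun y => Real.sqrt (‖u y‖ ^ 2 + 1) ^ 3 - 1)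
      ((3 * Real.sqrt (‖u x‖ ^ 2 + 1)) • (innerSL ℝ (u x)).comp u') x := by
  have hpos : 0 < Real.sqrt (‖u x‖ ^ 2 + 1) := sqrt_normSq_add_one_pos (u x)
  have h1 := hasFDerivAt_sqrt_normSq_add_one hu
  refine ((h1.pow 3).sub_const 1).congr_fderiv (ContinuousLinearMap.ext fun w => ?_)
  simp only [_root_.smul_apply, ContinuousLinearMap.comp_apply, innerSL_apply_apply,
    smul_eq_mul, nsmul_eq_mul, Nat.cast_ofNat]
  field_simp

/-- The weight applied: `D(√(‖u‖²+1))(x) w = ρ(x)⁻¹ ⟪u x, Du(x) w⟫`. [folklore] -/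
theorem fderiv_sqrt_normSq_add_one_apply {u : G → E} {x : G} (hu : DifferentiableAt ℝ u x)
    (w : G) :
    fderiv ℝ (fun y => Real.sqrt (‖u y‖ ^ 2 + 1)) x w =
      (Real.sqrt (‖u x‖ ^ 2 + 1))⁻¹ * ⟪u x, fderiv ℝ u x w⟫ := by
  rw [(hasFDerivAt_sqrt_normSq_add_one hu.hasFDerivAt).fderiv]
  simp only [_root_.smul_apply, ContinuousLinearMap.comp_apply, innerSL_apply_apply,
    smul_eq_mul]

/-- The regularised cube applied: `D(Φ∘u)(x) w = 3ρ(x) ⟪u x, Du(x) w⟫`. [folklore] -/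
theorem fderiv_phi_apply {u : G → E} {x : G} (hu : DifferentiableAt ℝ u x) (w : G) :
    fderiv ℝ (fun y => Real.sqrt (‖u y‖ ^ 2 + 1) ^ 3 - 1) x w =
      3 * Real.sqrt (‖u x‖ ^ 2 + 1) * ⟪u x, fderiv ℝ u x w⟫ := by
  rw [(hasFDerivAt_phi hu.hasFDerivAt).fderiv]
  simp only [_root_.smul_apply, ContinuousLinearMap.comp_apply, innerSL_apply_apply,
    smul_eq_mul]

/-- The weight is `C^n` along a `C^n` field. [folklore] -/
theorem contDiff_sqrt_normSq_add_one {n : ℕ∞} {u : G → E} (hu : ContDiff ℝ n u) :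
    ContDiff ℝ n (fun y => Real.sqrt (‖u y‖ ^ 2 + 1)) :=
  ((hu.norm_sq (𝕜 := ℝ)).add contDiff_const).sqrt fun x => by positivity

/-- The regularised cube is `C^n` along a `C^n` field. [folklore] -/
theorem contDiff_phi {n : ℕ∞} {u : G → E} (hu : ContDiff ℝ n u) :
    ContDiff ℝ n (fun y => Real.sqrt (‖u y‖ ^ 2 + 1) ^ 3 - 1) :=
  ((contDiff_sqrt_normSq_add_one hu).pow 3).sub contDiff_const

end Calculus

/-! ### Integrability helpers -/

section Integrability

variable {X : Type*} [MeasurableSpace X] {μ : Measure X}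
variable {F₁ F₂ : Type*} [NormedAddCommGroup F₁] [NormedAddCommGroup F₂]

/-- `‖f‖‖g‖ ∈ L¹` for `f, g ∈ L²` (Hölder). [folklore] -/
theorem integrable_norm_mul_norm {f : X → F₁} {g : X → F₂} (hf : MemLp f 2 μ) (hg : MemLp g 2 μ) :
    Integrable (fun x => ‖f x‖ * ‖g x‖) μ := by
  have h := hf.norm.integrable_mul hg.norm
  exact h

/-- `‖f‖² ∈ L¹` for `f ∈ L²`. [folklore] -/
theorem integrable_norm_sq {f : X → F₁} (hf : MemLp f 2 μ) :
    Integrable (fun x => ‖f x‖ ^ 2) μ := by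
  have h := integrable_norm_mul_norm hf hf
  refine h.congr (Eventually.of_forall fun x => ?_)
  simp [sq]

end Integrability

end LogCubeSharp

end Summit.NavierStokesRegularity.NavierStokesRegularity.Theorems

end
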